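import Literature.Probability.LatticeModels.KCEndRun
import Literature.Probability.LatticeModels.KCFrozenLoop
import Literature.Probability.LatticeModels.KCLatticeWindows
import Literature.Topology.PlaneTopology.StraightCrossCertificate
import HarnessLib

/-!
# The per-scale contour of the sign-condition argument and its avoided plaquettes

Topic `Literature/Probability/LatticeModels`. The contour `C` of the lattice sign-condition
argument (Chelkak–Smirnov 2012, proof of Thm. 6.1: "`C^δ` ... the part of `Ω^δ` lying inside
`C`") at one mesh, in lattice units: two ENDS on the frozen skeleton (`KCEndRun.lean`: the
half-diagonal from the `ℓ¹`-nearest frozen site `a_e` to the centre of the plaquette `c₀^e`,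
the straight run of plaquette centres `c₀^e … c_{N₀}^e`, and the connector to the base point
`Z_e`) joined by a MIDDLE (a path `M₁` from `Z₀` to `Q₁`, the straight flat piece `[Q₁, Q₂]`, a
path `M₂` from `Q₂` to `Z₁`). We define the avoided set of plaquettes
`Cset = {f : the closed square of f meets C ∖ {a₀, a₁}}` and prove:

* `runPt_mem_Cset` — the run plaquettes `c_n^e`, `n ≤ N₀`, are avoided (hypothesis `hrunE`);
* `mem_Cset_cases` — an avoided plaquette meets the middle, or a connector, or IS a run
  plaquette `c_i^e`, `i ≤ N₀` (the shape of hypothesis `hcarry`);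
* `endSet_subset_l1ball` — the ends lie in the closed `ℓ¹`-diamonds of radius `l1dist a_e Z_e`
  about `Z_e`;
* **`exists_closingPath`** — a path from `Q₂` back to `Q₁` inside `(C ∖ {a₀, a₁}) ∪ frozenSkeleton Λ`
  (middle, ends, and a frozen path between the two frozen ends, `exists_path_frozenSkeleton`),
  i.e. the closing path of the winding certificate
  `Literature.Topology.PlaneTopology.exists_mem_of_straightCross`;
* **`not_touchReachable_of_certificate`** — consequently, given the two transport paths of the
  certificate, no plaquette `g` beyond the contour is reachable from the seed by touching steps
  off `Cset` (`not_touchReachable_of_separated`).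

All `[folklore]` glue; no named fact.

## References

* D. Chelkak, S. Smirnov, Invent. Math. 189 (2012) = arXiv:0910.2045, proof of Thm. 6.1. [ChelkakSmirnov2012Ising]
-/

noncomputable section

open Set

namespace Literature.Probability.LatticeModels

open Site WeakBeurling Literature.Topology.PlaneTopology

/-! ### `ℓ¹`-balls in the plane -/

/-- The `ℓ¹` norm is subadditive. [folklore] -/
theorem l1norm_add_le (v w : ℂ) : l1norm (v + w) ≤ l1norm v + l1norm w := by
  simp only [l1norm, Complex.add_re, Complex.add_im]
  linarith [abs_add_le v.re w.re, abs_add_le v.im w.im]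

/-- The `ℓ¹` norm is absolutely homogeneous. [folklore] -/
theorem l1norm_smul (t : ℝ) (v : ℂ) : l1norm (t • v) = |t| * l1norm v := by
  simp only [l1norm, Complex.smul_re, Complex.smul_im, smul_eq_mul, abs_mul]
  ring

/-- The `ℓ¹` norm dominates the Euclidean norm. [folklore] -/
theorem norm_le_l1norm (v : ℂ) : ‖v‖ ≤ l1norm v := Complex.norm_le_abs_re_add_abs_im v

/-- The `ℓ¹` norm is at most twice the Euclidean norm. [folklore] -/
theorem l1norm_le_two_mul_norm (v : ℂ) : l1norm v ≤ 2 * ‖v‖ := by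
  simp only [l1norm]
  linarith [Complex.abs_re_le_norm v, Complex.abs_im_le_norm v]

/-- Closed `ℓ¹`-balls are convex: segments between two points of the ball stay in it. [folklore] -/
theorem l1norm_sub_le_of_mem_segment {Z x y : ℂ} {m : ℝ} (hx : l1norm (x - Z) ≤ m) (hy : l1norm (y - Z) ≤ m)
    {w : ℂ} (hw : w ∈ segment ℝ x y) : l1norm (w - Z) ≤ m := by
  obtain ⟨s, t, hs, ht, hst, rfl⟩ := hw
  have : s • x + t • y - Z = s • (x - Z) + t • (y - Z) := by
    rw [smul_sub, smul_sub]
    have hZ : (s + t) • Z = Z := by rw [hst, one_smul]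
    rw [add_smul] at hZ
    calc s • x + t • y - Z = s • x + t • y - (s • Z + t • Z) := by rw [hZ]
      _ = s • x - s • Z + (t • y - t • Z) := by abel
  rw [this]
  calc l1norm (s • (x - Z) + t • (y - Z)) ≤ l1norm (s • (x - Z)) + l1norm (t • (y - Z)) := l1norm_add_le _ _
    _ = s * l1norm (x - Z) + t * l1norm (y - Z) := by rw [l1norm_smul, l1norm_smul, abs_of_nonneg hs, abs_of_nonneg ht]
    _ ≤ s * m + t * m := by gcongr
    _ = m := by rw [← add_mul, hst, one_mul]

/-- `l1dist` is the `ℓ¹` norm of the difference. [folklore] -/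
theorem l1dist_eq_l1norm (v : Site 2) (z : ℂ) : l1dist v z = l1norm (toComplex v - z) := by
  simp [l1dist, l1norm]

/-! ### The contour -/

section Contour

variable (a : Fin 2 → Site 2) (k j₁ : Fin 2 → Fin 4) (N₀ : ℕ) (Z : Fin 2 → ℂ)
  {Q₁ Q₂ : ℂ} (M₁ : Path (Z 0) Q₁) (M₂ : Path Q₂ (Z 1))

/-- The run plaquettes of end `e`: `c_n^e = runPt (faceAt a_e j₁^e) k^e n`. [folklore] -/
def endRunPt (e : Fin 2) (n : ℤ) : Site 2 := runPt (faceAt (a e) (j₁ e)) (k e) n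

/-- The end piece of the contour as a path from the frozen site `a_e` to the base point `Z_e`:
half-diagonal to the centre of `c₀^e`, straight run to the centre of `c_{N₀}^e`, connector to `Z_e`.
[cite: ChelkakSmirnov2012Ising, proof of Thm. 6.1 (the ends of C^δ)] -/
def endPath (e : Fin 2) : Path (toComplex (a e)) (Z e) :=
  (Path.segment (toComplex (a e)) (plaqCentre (endRunPt a k j₁ e 0))).trans
    ((Path.segment (plaqCentre (endRunPt a k j₁ e 0)) (plaqCentre (endRunPt a k j₁ e N₀))).trans
      (Path.segment (plaqCentre (endRunPt a k j₁ e N₀)) (Z e)))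

/-- The end piece as a set: the union of its three segments. [folklore] -/
theorem range_endPath (e : Fin 2) : range (endPath a k j₁ N₀ Z e) =
    segment ℝ (toComplex (a e)) (plaqCentre (endRunPt a k j₁ e 0)) ∪
      (segment ℝ (plaqCentre (endRunPt a k j₁ e 0)) (plaqCentre (endRunPt a k j₁ e N₀)) ∪
        segment ℝ (plaqCentre (endRunPt a k j₁ e N₀)) (Z e)) := by
  rw [endPath, Path.trans_range, Path.trans_range, Path.range_segment, Path.range_segment, Path.range_segment]

/-- The middle of the contour as a set. [folklore] -/
def midSet : Set ℂ := range M₁ ∪ segment ℝ Q₁ Q₂ ∪ range M₂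

/-- **The contour** `C = C^{end}_0 ∪ M ∪ C^{end}_1`. [cite: ChelkakSmirnov2012Ising, proof of Thm. 6.1 (C^δ)] -/
def contour : Set ℂ := range (endPath a k j₁ N₀ Z 0) ∪ midSet Z M₁ M₂ ∪ range (endPath a k j₁ N₀ Z 1)

/-- The contour without its two frozen endpoints (planar realisations of touching paths never
pass through frozen sites, so only this part needs to be avoided). [folklore] -/
def contourMinus : Set ℂ := contour a k j₁ N₀ Z M₁ M₂ \ {toComplex (a 0), toComplex (a 1)}

/-- **The avoided plaquettes**: those whose closed square meets `C ∖ {a₀, a₁}`. [cite: ChelkakSmirnov2012Ising, proof of Thm. 6.1 (C^δ)] -/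
def Cset : Set (Site 2) := {f | (plaqClosedSq f ∩ contourMinus a k j₁ N₀ Z M₁ M₂).Nonempty}

/-- Plaquette centres are never sites. [folklore] -/
theorem plaqCentre_ne_toComplex (f v : Site 2) : plaqCentre f ≠ toComplex v := by
  intro h
  have := congrArg Complex.re h
  simp only [plaqCentre, toComplex_re] at this
  have h2 : (2 : ℝ) * f 0 + 1 = 2 * v 0 := by linarith
  have h3 : (2 * f 0 + 1 : ℤ) = 2 * v 0 := by exact_mod_cast h2
  omega

/-- The centres of the run plaquettes lie on the run segment. [folklore] -/
theorem plaqCentre_endRunPt_mem_segment (e : Fin 2) {n : ℕ} (hn : n ≤ N₀) :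
    plaqCentre (endRunPt a k j₁ e n) ∈ segment ℝ (plaqCentre (endRunPt a k j₁ e 0)) (plaqCentre (endRunPt a k j₁ e N₀)) := by
  rcases Nat.eq_zero_or_pos N₀ with h0 | hpos
  · subst h0
    have : n = 0 := Nat.le_zero.1 hn
    subst this
    exact left_mem_segment ℝ _ _
  · rw [segment_eq_image']
    refine ⟨(n : ℝ) / N₀, ⟨by positivity, div_le_one_of_le₀ (by exact_mod_cast hn) (by positivity)⟩, ?_⟩
    have hN : (N₀ : ℝ) ≠ 0 := by exact_mod_cast hpos.ne'
    apply Complex.ext <;>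
      simp only [plaqCentre, endRunPt, runPt_apply, Complex.add_re, Complex.add_im, Complex.smul_re, Complex.smul_im,
        Complex.sub_re, Complex.sub_im, smul_eq_mul, Int.cast_add, Int.cast_mul, Int.cast_natCast,
        zero_mul, add_zero] <;> field_simp <;> ring

/-- **The run plaquettes are avoided** (`c_n^e ∈ Cset` for `n ≤ N₀`). [folklore] -/
theorem endRunPt_mem_Cset (e : Fin 2) {n : ℕ} (hn : n ≤ N₀) : endRunPt a k j₁ e n ∈ Cset a k j₁ N₀ Z M₁ M₂ := by
  refine ⟨plaqCentre (endRunPt a k j₁ e n), plaqCentre_mem_plaqClosedSq _, ?_, ?_⟩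
  · have hmem : plaqCentre (endRunPt a k j₁ e n) ∈ range (endPath a k j₁ N₀ Z e) := by
      rw [range_endPath]
      exact Or.inr (Or.inl (plaqCentre_endRunPt_mem_segment a k j₁ N₀ e hn))
    fin_cases e
    · exact Or.inl (Or.inl hmem)
    · exact Or.inr hmem
  · rintro (h | h) <;> exact plaqCentre_ne_toComplex _ _ h

/-- Integer bookkeeping along the run: a unit interval `[f, f+1]` containing `c + ½ + σ t`,
`t ∈ [0, N₀]`, `σ = ±1`, has `f = c + σ i` for some `i ≤ N₀`. [folklore] -/
theorem exists_eq_add_of_mem_run {f c : ℤ} {σ : ℤ} (hσ : σ = 1 ∨ σ = -1) {t : ℝ} (ht0 : 0 ≤ t) (htN : t ≤ N₀)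
    (h1 : (f : ℝ) ≤ c + 1 / 2 + σ * t) (h2 : (c : ℝ) + 1 / 2 + σ * t ≤ f + 1) : ∃ i : ℕ, i ≤ N₀ ∧ f = c + σ * i := by
  rcases hσ with rfl | rfl
  · push_cast at h1 h2
    have hlo : (-1 : ℝ) < ((f - c : ℤ) : ℝ) := by push_cast; linarith
    have hhi : ((f - c : ℤ) : ℝ) < (N₀ : ℝ) + 1 := by push_cast; linarith
    have hlo' : -1 < f - c := by exact_mod_cast hlo
    have hhi' : f - c < N₀ + 1 := by exact_mod_cast hhi
    refine ⟨(f - c).toNat, by omega, by omega⟩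
  · push_cast at h1 h2
    have hlo : (-1 : ℝ) < ((c - f : ℤ) : ℝ) := by push_cast; linarith
    have hhi : ((c - f : ℤ) : ℝ) < (N₀ : ℝ) + 1 := by push_cast; linarith
    have hlo' : -1 < c - f := by exact_mod_cast hlo
    have hhi' : c - f < N₀ + 1 := by exact_mod_cast hhi
    refine ⟨(c - f).toNat, by omega, by omega⟩

/-- The lateral coordinate: a unit interval `[f, f+1]` containing `c + ½` has `f = c`. [folklore] -/
theorem eq_of_mem_half {f c : ℤ} (h1 : (f : ℝ) ≤ c + 1 / 2) (h2 : (c : ℝ) + 1 / 2 ≤ f + 1) : f = c := by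
  have hlo : (-1 : ℝ) < ((f - c : ℤ) : ℝ) := by push_cast; linarith
  have hhi : ((f - c : ℤ) : ℝ) < 1 := by push_cast; linarith
  have hlo' : -1 < f - c := by exact_mod_cast hlo
  have hhi' : f - c < 1 := by exact_mod_cast hhi
  omega

/-- A closed square meeting the run segment is a run plaquette. [folklore] -/
theorem eq_endRunPt_of_mem_runSegment (e : Fin 2) {f : Site 2} {w : ℂ} (hw : w ∈ plaqClosedSq f)
    (hws : w ∈ segment ℝ (plaqCentre (endRunPt a k j₁ e 0)) (plaqCentre (endRunPt a k j₁ e N₀))) :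
    ∃ i : ℕ, i ≤ N₀ ∧ f = endRunPt a k j₁ e i := by
  rw [segment_eq_image'] at hws
  obtain ⟨θ, ⟨hθ0, hθ1⟩, rfl⟩ := hws
  obtain ⟨h1, h2, h3, h4⟩ := hw
  simp only [plaqCentre, endRunPt, runPt_apply, Complex.add_re, Complex.add_im, Complex.smul_re, Complex.smul_im,
    Complex.sub_re, Complex.sub_im, smul_eq_mul, Int.cast_add, Int.cast_mul, Int.cast_natCast,
    zero_mul, add_zero] at h1 h2 h3 h4
  set c₀ := faceAt (a e) (j₁ e) with hc₀
  have ht0 : 0 ≤ θ * N₀ := by positivity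
  have htN : θ * N₀ ≤ N₀ := by nlinarith
  have key : ∀ i : ℕ, f = endRunPt a k j₁ e i ↔ f 0 = c₀ 0 + i * cornerUnit (k e) 0 ∧ f 1 = c₀ 1 + i * cornerUnit (k e) 1 := by
    intro i
    constructor
    · intro h; rw [h]; simp [endRunPt, hc₀]
    · intro h; ext l; fin_cases l <;> simp [endRunPt, hc₀, h.1, h.2]
  simp only [key]
  -- the four directions
  have hk : k e = 0 ∨ k e = 1 ∨ k e = 2 ∨ k e = 3 := by
    rcases k e with ⟨i, hi⟩
    interval_cases i <;> simp [Fin.ext_iff]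
  rcases hk with hk | hk | hk | hk <;> rw [hk] at h1 h2 h3 h4 ⊢ <;> simp at h1 h2 h3 h4 ⊢
  · obtain ⟨i, hi, hf⟩ := exists_eq_add_of_mem_run N₀ (f := f 0) (c := c₀ 0) (σ := 1) (Or.inl rfl) ht0 htN
      (by push_cast; linarith) (by push_cast; linarith)
    exact ⟨i, hi, by omega, eq_of_mem_half (by linarith) (by linarith)⟩
  · obtain ⟨i, hi, hf⟩ := exists_eq_add_of_mem_run N₀ (f := f 1) (c := c₀ 1) (σ := 1) (Or.inl rfl) ht0 htN
      (by push_cast; linarith) (by push_cast; linarith)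
    exact ⟨i, hi, eq_of_mem_half (by linarith) (by linarith), by omega⟩
  · obtain ⟨i, hi, hf⟩ := exists_eq_add_of_mem_run N₀ (f := f 0) (c := c₀ 0) (σ := -1) (Or.inr rfl) ht0 htN
      (by push_cast; linarith) (by push_cast; linarith)
    exact ⟨i, hi, by omega, eq_of_mem_half (by linarith) (by linarith)⟩
  · obtain ⟨i, hi, hf⟩ := exists_eq_add_of_mem_run N₀ (f := f 1) (c := c₀ 1) (σ := -1) (Or.inr rfl) ht0 htN
      (by push_cast; linarith) (by push_cast; linarith)
    exact ⟨i, hi, eq_of_mem_half (by linarith) (by linarith), by omega⟩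

/-- The frozen site `a_e` is a corner of `c₀^e = faceAt a_e j₁^e`. [folklore] -/
theorem isCornerOf_endRunPt_zero (e : Fin 2) : IsCornerOf (endRunPt a k j₁ e 0) (a e) := by
  have : a e = faceAt (a e) (j₁ e) + cornerOff (j₁ e) := by simp [faceAt]
  rw [endRunPt, runPt_zero]
  conv_rhs => rw [this]
  exact isCornerOf_add_cornerOff _ _

/-- A closed square meeting the half-diagonal off its frozen endpoint is `c₀^e`. [folklore] -/
theorem eq_endRunPt_zero_of_mem_halfDiagonal (e : Fin 2) {f : Site 2} {w : ℂ} (hw : w ∈ plaqClosedSq f)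
    (hws : w ∈ segment ℝ (toComplex (a e)) (plaqCentre (endRunPt a k j₁ e 0))) (hwa : w ≠ toComplex (a e)) :
    f = endRunPt a k j₁ e 0 := by
  rw [segment_symm] at hws
  obtain ⟨⟨h1, h2⟩, ⟨h3, h4⟩⟩ := re_im_mem_Ioo_of_mem_segment (isCornerOf_endRunPt_zero a k j₁ e) hws hwa
  obtain ⟨g1, g2, g3, g4⟩ := hw
  have e0 : f 0 = endRunPt a k j₁ e 0 0 := by
    have lo : ((f 0 : ℤ) : ℝ) - 1 < (endRunPt a k j₁ e 0 0 : ℝ) := by linarith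
    have hi : ((endRunPt a k j₁ e 0 0 : ℤ) : ℝ) < (f 0 : ℝ) + 1 := by linarith
    have lo' : f 0 - 1 < endRunPt a k j₁ e 0 0 := by exact_mod_cast lo
    have hi' : endRunPt a k j₁ e 0 0 < f 0 + 1 := by exact_mod_cast hi
    omega
  have e1 : f 1 = endRunPt a k j₁ e 0 1 := by
    have lo : ((f 1 : ℤ) : ℝ) - 1 < (endRunPt a k j₁ e 0 1 : ℝ) := by linarith
    have hi : ((endRunPt a k j₁ e 0 1 : ℤ) : ℝ) < (f 1 : ℝ) + 1 := by linarith
    have lo' : f 1 - 1 < endRunPt a k j₁ e 0 1 := by exact_mod_cast lo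
    have hi' : endRunPt a k j₁ e 0 1 < f 1 + 1 := by exact_mod_cast hi
    omega
  ext l; fin_cases l
  · exact e0
  · exact e1

/-- **The shape of the avoided set** (hypothesis `hcarry`): an avoided plaquette meets the middle,
or one of the two connectors, or is a run plaquette `c_i^e`, `i ≤ N₀`. [folklore] -/
theorem mem_Cset_cases {f : Site 2} (hf : f ∈ Cset a k j₁ N₀ Z M₁ M₂) :
    (∃ w ∈ plaqClosedSq f, w ∈ midSet Z M₁ M₂) ∨
      (∃ e : Fin 2, ∃ w ∈ plaqClosedSq f, w ∈ segment ℝ (plaqCentre (endRunPt a k j₁ e N₀)) (Z e)) ∨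
        (∃ e : Fin 2, ∃ i : ℕ, i ≤ N₀ ∧ f = endRunPt a k j₁ e i) := by
  obtain ⟨w, hwf, hwC, hwa⟩ := hf
  simp only [Set.mem_insert_iff, Set.mem_singleton_iff, not_or] at hwa
  have hend : ∀ e : Fin 2, w ∈ range (endPath a k j₁ N₀ Z e) →
      (∃ e : Fin 2, ∃ w ∈ plaqClosedSq f, w ∈ segment ℝ (plaqCentre (endRunPt a k j₁ e N₀)) (Z e)) ∨
        (∃ e : Fin 2, ∃ i : ℕ, i ≤ N₀ ∧ f = endRunPt a k j₁ e i) := by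
    intro e hw
    rw [range_endPath] at hw
    rcases hw with hw | hw | hw
    · have hwa' : w ≠ toComplex (a e) := by fin_cases e; exacts [hwa.1, hwa.2]
      exact Or.inr ⟨e, 0, Nat.zero_le _, eq_endRunPt_zero_of_mem_halfDiagonal a k j₁ e hwf hw hwa'⟩
    · exact Or.inr ⟨e, eq_endRunPt_of_mem_runSegment a k j₁ N₀ e hwf hw⟩
    · exact Or.inl ⟨e, w, hwf, hw⟩
  rcases hwC with (hw | hw) | hw
  · exact Or.inr (hend 0 hw)
  · exact Or.inl ⟨w, hwf, hw⟩
  · exact Or.inr (hend 1 hw)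

/-- **The ends lie in the closed `ℓ¹`-diamonds** of radius `l1dist a_e Z_e` about `Z_e` (given
the two centre estimates of `exists_endRun`). [folklore] -/
theorem l1norm_le_of_mem_range_endPath (e : Fin 2)
    (h0 : l1norm (plaqCentre (endRunPt a k j₁ e 0) - Z e) ≤ l1dist (a e) (Z e))
    (hN : l1norm (plaqCentre (endRunPt a k j₁ e N₀) - Z e) ≤ l1dist (a e) (Z e))
    {w : ℂ} (hw : w ∈ range (endPath a k j₁ N₀ Z e)) : l1norm (w - Z e) ≤ l1dist (a e) (Z e) := by
  have ha : l1norm (toComplex (a e) - Z e) ≤ l1dist (a e) (Z e) := (l1dist_eq_l1norm _ _).symm.le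
  have hZ : l1norm (Z e - Z e) ≤ l1dist (a e) (Z e) := by
    rw [sub_self]; simp only [l1norm, Complex.zero_re, Complex.zero_im, abs_zero, add_zero]; exact l1dist_nonneg _ _
  rw [range_endPath] at hw
  rcases hw with hw | hw | hw
  · exact l1norm_sub_le_of_mem_segment ha h0 hw
  · exact l1norm_sub_le_of_mem_segment h0 hN hw
  · exact l1norm_sub_le_of_mem_segment hN hZ hw

/-- The connector stays within the `ℓ¹`-radius of its inner end. [folklore] -/
theorem l1norm_le_of_mem_connector (e : Fin 2) {ρ : ℝ} (hN : l1norm (plaqCentre (endRunPt a k j₁ e N₀) - Z e) ≤ ρ) (hρ : 0 ≤ ρ)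
    {w : ℂ} (hw : w ∈ segment ℝ (plaqCentre (endRunPt a k j₁ e N₀)) (Z e)) : l1norm (w - Z e) ≤ ρ := by
  refine l1norm_sub_le_of_mem_segment hN ?_ hw
  rw [sub_self]; simpa [l1norm] using hρ

/-- Plaquettes whose centre is at distance `> 1` from the contour are not avoided. [folklore] -/
theorem not_mem_Cset_of_dist {f : Site 2} (h : ∀ w ∈ contour a k j₁ N₀ Z M₁ M₂, 1 < dist (plaqCentre f) w) :
    f ∉ Cset a k j₁ N₀ Z M₁ M₂ := by
  rintro ⟨w, hwf, hwC, -⟩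
  exact absurd (dist_plaqCentre_le_of_mem_plaqClosedSq hwf) (not_le.2 (h w hwC))

/-- Avoided plaquettes have their centre within distance `1` of the contour. [folklore] -/
theorem exists_dist_le_of_mem_Cset {f : Site 2} (hf : f ∈ Cset a k j₁ N₀ Z M₁ M₂) :
    ∃ w ∈ contour a k j₁ N₀ Z M₁ M₂, dist (plaqCentre f) w ≤ 1 := by
  obtain ⟨w, hwf, hwC, -⟩ := hf
  exact ⟨w, hwC, dist_plaqCentre_le_of_mem_plaqClosedSq hwf⟩

/-! ### The closing path and the certificate -/

/-- **The closing path of the winding certificate**: from `Q₂` along `M₂` to `Z₁`, back along the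
end piece to the frozen site `a₁`, through the frozen skeleton to `a₀` (`exists_path_frozenSkeleton`),
along the end piece to `Z₀`, and along `M₁` to `Q₁`. [cite: ChelkakSmirnov2012Ising, proof of Thm. 6.1 (∂D^δ ⊂ C^δ ∪ ∂Ω^δ)] -/
theorem exists_closingPath {Λ : Finset (Site 2)} (hΛ : HoleFree (Λ : Set (Site 2))) (ha : ∀ e, a e ∉ Λ) :
    ∃ γ : Path Q₂ Q₁, ∀ t,
      γ t ∈ range M₁ ∪ range M₂ ∪ range (endPath a k j₁ N₀ Z 0) ∪ range (endPath a k j₁ N₀ Z 1) ∨ γ t ∈ frozenSkeleton Λ := by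
  obtain ⟨φ, hφ⟩ := exists_path_frozenSkeleton hΛ (ha 1) (ha 0)
  refine ⟨M₂.trans ((endPath a k j₁ N₀ Z 1).symm.trans (φ.trans ((endPath a k j₁ N₀ Z 0).trans M₁))), fun t => ?_⟩
  have ht := mem_range_self (f := M₂.trans ((endPath a k j₁ N₀ Z 1).symm.trans (φ.trans ((endPath a k j₁ N₀ Z 0).trans M₁)))) t
  simp only [Path.trans_range, Path.symm_range] at ht
  rcases ht with h | h | ⟨t', ht'⟩ | h | h
  · exact Or.inl (Or.inl (Or.inl (Or.inr h)))
  · exact Or.inl (Or.inr h)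
  · exact Or.inr (ht' ▸ hφ t')
  · exact Or.inl (Or.inl (Or.inr h))
  · exact Or.inl (Or.inl (Or.inl (Or.inl h)))

/-- Points of the pieces of the contour lie in `C ∖ {a₀, a₁}` or on the frozen skeleton. [folklore] -/
theorem mem_contourMinus_or_frozenSkeleton {Λ : Finset (Site 2)} (hΛ : HoleFree (Λ : Set (Site 2))) (ha : ∀ e, a e ∉ Λ)
    {w : ℂ} (hw : w ∈ range M₁ ∪ range M₂ ∪ range (endPath a k j₁ N₀ Z 0) ∪ range (endPath a k j₁ N₀ Z 1)) :
    w ∈ contourMinus a k j₁ N₀ Z M₁ M₂ ∨ w ∈ frozenSkeleton Λ := by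
  by_cases h : w = toComplex (a 0) ∨ w = toComplex (a 1)
  · right
    rcases h with rfl | rfl <;> exact toComplex_mem_frozenSkeleton hΛ (ha _)
  · left
    refine ⟨?_, by simpa only [Set.mem_insert_iff, Set.mem_singleton_iff] using h⟩
    rcases hw with ((hw | hw) | hw) | hw
    · exact Or.inl (Or.inr (Or.inl (Or.inl hw)))
    · exact Or.inl (Or.inr (Or.inr hw))
    · exact Or.inl (Or.inl hw)
    · exact Or.inr hw

/-- **Separation by the contour and the frozen skeleton (winding certificate).** Suppose the
short segment `[ℓ, r]` crosses the flat piece `[Q₁, Q₂]` (`Q₁` strictly on the positive, `Q₂` on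
the negative side of the line `ℓ r`, the segments meeting inside `(ℓ, r)`), misses the other
pieces of the contour and the frozen skeleton, the flat piece misses the two frozen ends, and `z`
is joined to `ℓ`, `r` to `w`, by paths missing the contour and the frozen skeleton. Then every
path from `z` to `w` missing the frozen skeleton meets `C ∖ {a₀, a₁}`. [cite: ChelkakSmirnov2012Ising, proof of Thm. 6.1 (D^δ lies inside C)] -/
theorem exists_mem_contourMinus_of_certificate {Λ : Finset (Site 2)} (hΛ : HoleFree (Λ : Set (Site 2))) (ha : ∀ e, a e ∉ Λ)
    {ℓ r : ℂ} (hA : 0 < segSide ℓ r Q₁) (hB : segSide ℓ r Q₂ < 0) (hx : ∃ p ∈ segment ℝ Q₁ Q₂, p ∈ openSegment ℝ ℓ r)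
    (hpieces : ∀ w ∈ range M₁ ∪ range M₂ ∪ range (endPath a k j₁ N₀ Z 0) ∪ range (endPath a k j₁ N₀ Z 1), w ∉ segment ℝ ℓ r)
    (hSk : ∀ w ∈ frozenSkeleton Λ, w ∉ segment ℝ ℓ r) (hQa : ∀ e, toComplex (a e) ∉ segment ℝ Q₁ Q₂)
    {z w : ℂ} (Pz : Path z ℓ) (hPz : ∀ t, Pz t ∉ contour a k j₁ N₀ Z M₁ M₂ ∧ Pz t ∉ frozenSkeleton Λ)
    (Pw : Path r w) (hPw : ∀ t, Pw t ∉ contour a k j₁ N₀ Z M₁ M₂ ∧ Pw t ∉ frozenSkeleton Λ)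
    (β : Path z w) (hβ : ∀ t, β t ∉ frozenSkeleton Λ) : ∃ t, β t ∈ contourMinus a k j₁ N₀ Z M₁ M₂ := by
  obtain ⟨γ, hγ⟩ := exists_closingPath a k j₁ N₀ Z M₁ M₂ hΛ ha
  have hγST : ∀ t, γ t ∈ contourMinus a k j₁ N₀ Z M₁ M₂ ∪ frozenSkeleton Λ := fun t => by
    rcases hγ t with h | h
    · exact mem_contourMinus_or_frozenSkeleton a k j₁ N₀ Z M₁ M₂ hΛ ha h
    · exact Or.inr h
  have hseg : segment ℝ Q₁ Q₂ ⊆ contourMinus a k j₁ N₀ Z M₁ M₂ := fun p hp =>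
    ⟨Or.inl (Or.inr (Or.inl (Or.inr hp))), by
      simp only [Set.mem_insert_iff, Set.mem_singleton_iff, not_or]
      exact ⟨fun h => hQa 0 (h ▸ hp), fun h => hQa 1 (h ▸ hp)⟩⟩
  have hγℓr : ∀ t, γ t ∉ segment ℝ ℓ r := fun t => by
    rcases hγ t with h | h
    · exact hpieces _ h
    · exact hSk _ h
  have hsub : contourMinus a k j₁ N₀ Z M₁ M₂ ⊆ contour a k j₁ N₀ Z M₁ M₂ := Set.sdiff_subset
  refine exists_mem_of_straightCross γ hA hB hx hγℓr Pz ?_ Pw ?_ hseg hγST β hβ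
  · exact ne_straightLoop_of_not_mem γ hseg hγST Pz fun t => ⟨fun h => (hPz t).1 (hsub h), (hPz t).2⟩
  · exact ne_straightLoop_of_not_mem γ hseg hγST Pw fun t => ⟨fun h => (hPw t).1 (hsub h), (hPw t).2⟩

/-- **No plaquette beyond the contour is reachable from the seed.** With the certificate data of
`exists_mem_contourMinus_of_certificate`, the seed plaquette `f₀ ∉ Cset` joined from `r` and the
plaquette `g` joined to `ℓ`: `g ∉ touchReach Λ Cset f₀`. [cite: ChelkakSmirnov2012Ising, proof of Thm. 6.1 (D^δ)] -/
theorem not_mem_touchReach_of_certificate {Λ : Finset (Site 2)} (hΛ : HoleFree (Λ : Set (Site 2))) (ha : ∀ e, a e ∉ Λ)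
    {ℓ r : ℂ} (hA : 0 < segSide ℓ r Q₁) (hB : segSide ℓ r Q₂ < 0) (hx : ∃ p ∈ segment ℝ Q₁ Q₂, p ∈ openSegment ℝ ℓ r)
    (hpieces : ∀ w ∈ range M₁ ∪ range M₂ ∪ range (endPath a k j₁ N₀ Z 0) ∪ range (endPath a k j₁ N₀ Z 1), w ∉ segment ℝ ℓ r)
    (hSk : ∀ w ∈ frozenSkeleton Λ, w ∉ segment ℝ ℓ r) (hQa : ∀ e, toComplex (a e) ∉ segment ℝ Q₁ Q₂)
    {f₀ g : Site 2} (h₀ : f₀ ∉ Cset a k j₁ N₀ Z M₁ M₂)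
    (Pz : Path (plaqCentre g) ℓ) (hPz : ∀ t, Pz t ∉ contour a k j₁ N₀ Z M₁ M₂ ∧ Pz t ∉ frozenSkeleton Λ)
    (Pw : Path r (plaqCentre f₀)) (hPw : ∀ t, Pw t ∉ contour a k j₁ N₀ Z M₁ M₂ ∧ Pw t ∉ frozenSkeleton Λ) :
    g ∉ touchReach Λ (Cset a k j₁ N₀ Z M₁ M₂) f₀ := by
  refine not_mem_touchReach_of_separated h₀ (contourMinus a k j₁ N₀ Z M₁ M₂) (fun f hf => hf) fun β hβ => ?_
  obtain ⟨t, ht⟩ := exists_mem_contourMinus_of_certificate a k j₁ N₀ Z M₁ M₂ hΛ ha hA hB hx hpieces hSk hQa Pz hPz Pw hPw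
    β.symm fun t => by rw [Path.symm_apply]; exact hβ _
  exact ⟨_, by rw [Path.symm_apply] at ht; exact ht⟩

end Contour

end Literature.Probability.LatticeModels
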